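import Summits.QuantumFields.BalabanUV.T4Continuum.Support.RegularSupOfGauge
import Summits.QuantumFields.BalabanUV.T4Continuum.Support.SkeletonLattice
import HarnessLib

/-!
# T⁴ programme, node NE3 — THE ACTION SANDWICH, sub-row S3-H∃ items (a) + (c): the (9)_{β=1} gauge datum as a CUBE SHAPE,
# the cube-to-site covering, the `k`-UNIFORM regularity constant at the printed scales, and the re-instantiation
# «one minimiser per level in (8) with (9)_{β=1} data on the print-admissible cubes ⟹ (H∃)»

NE3 formalisation swarm `b2b-balaban-t4-ne3-formalise-*` of the cell `pub-balaban`, unit `b2b-balaban-t4-ne3-formalise-leaf-01`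
(gen 2), sub-row **S3-H∃** of `t4/formal/NE3/LEAVES.md` (owner RULING journal 2026-08-20T09:32Z, CORRECTION 09:34Z, NOTE 09:36Z
«item (b) IS FILED — `RegularSupOfGauge` p214267; PLEASE BUILD ON IT BY NAME for (a) the cube-to-ball covering, (c) the scale
arithmetic, and the re-instantiation ⟹ (H∃)»).  Item (b) (`RegularSupOfGauge.regularSup_of_localGauge`, owner): a unitary periodic
small-field configuration carrying, at EVERY site `x`, a local exponential gauge on the `ℓ¹`-ball of radius 2 with sup bounds
`α₀` (potential), `α₁` (first differences) and `α₂` (ALL mixed second differences at `x`) has `RegularSup d L N b c k U` as soon as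
`(2α₂ + kRem α₀ α₁)(L^k)³ ≤ c`.  THIS FILE ([folklore]; two `@[folklore]` hypothesis SHAPES, 0 sorry):

* `ExpGauge11 d U x α₀ α₁ α₂` — the per-site datum (= item (b)'s hypothesis `hgauge x` LITERALLY, as a named shape) and
  **`ExpGaugeCube11 d U y K α₀ α₁ α₂`** — THE CUBE FORM (B11 Thm 1 (8)+(9)_{β=1} p. 279 TYPE «for an arbitrary cube □ … there
  exists a gauge transformation u defined on a neighborhood of □ …»): ONE unitary gauge `u` and ONE potential `a` on the cube
  `box K y` with `U^u = exp a`, `‖a‖ ≤ α₀`, `‖∇_i a‖ ≤ α₁`, `‖∇_i∇_l a‖ ≤ α₂` there (= `AveragingDeficitKDatum.ExpGauge` with the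
  Laplacian slot replaced by ALL second differences — the owner's correction); asserted for NO configuration except the flat one;
* (a) **`expGauge11_of_cube`** (`x ∈ box R y`, `R + 2 ≤ K` ⟹ the cube datum gives the site datum at `x`, via
  `AveragingDeficitKDatum.mem_box_add_of_l1`), `mem_box_cdiv` (every site lies in the cube of radius `B − 1` at the base corner of
  its block, `SkeletonLattice.cdiv`∕`cmod`), **`expGauge11_of_blockCubes`** (cube data on `box (B+1) (B•q)` for every block index
  `q` ⟹ the site datum EVERYWHERE);
* (c) `scale_kRem` (`(2c₂/s³ + kRem (c₀/s) (c₁/s²))·s³ ≤ 2c₂ + 90c₀c₁ + 32c₁² + 360c₀³` for `s ≥ 1`, `c₀, c₁ ≤ 1/8` —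
  `AveragingDeficitKDatum.kRem_le'` and `s⁻⁴ ≤ s⁻³`) and **`regularSup_of_blockCubes`**: unitary + `(N·L^k)`-periodic +
  `SmallField U (b/(L^k)²)` (`b ≤ 1/2`) + cube data at the PRINTED scales `c₀/L^k`, `c₁/(L^k)²`, `c₂/(L^k)³` on the cubes of side
  `≈ 2L^k` around every block ⟹ `RegularSup d L N b (2c₂ + 90c₀c₁ + 32c₁² + 360c₀³) k U` — item (b) BY NAME, constant `k`-FREE;
* **`hex_of_thm1Global`** — THE RE-INSTANTIATION: the typed GLOBAL reading «∀ V ∈ dom, ∀ k, ∃ U, IsMinimiser d (sfClass d L N ε) L N k V U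
  ∧ U ∈ sfClass d L N b k ∧ (9)_{β=1} cube data at the printed scales» (B11 Thm 1 TYPE, minimiser over the class (6)_{ε₀} lying in
  (8)_{B₃ε₁} — label D-s3-2; a HYPOTHESIS) ⟹ (H∃) `∀ V ∈ dom, ∀ k, ∃ U, IsMinimiser … k V U ∧ RegularSup d L N b (2c₂ + …) k U`
  — the binder `hmin` of the owner's rate END `actionRate_sfClass_of_exists_approxRefine` ∕ `MinimalActionThm1Type`;
* non-vacuity at the flat configuration (`expGaugeCube11_flat`, `regularSup_flat_of_blockCubes`).

HONEST FRAMING.  DICTIONARY only: printed-TYPE sup data ⟹ the tree's `RegularSup`; nothing asserts that Bałaban's minimisers carry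
such gauges (that is B11 Theorem 1 itself, asserted by nobody in the tree); (H∃) stays a hypothesis of the route-(A) ENDs; **NE3 is
NOT proved**; NOT summit progress.  No printed sentence is a hypothesis of a theorem; nothing restated (item (b), `kRem`, `gaugeAct`,
`fd`, `box`, `cdiv`, `sfClass`, `IsMinimiser`, `RegularSup` BY NAME); no `def … : Prop` FACT (the two defs are parametric hypothesis
shapes like `ExpGauge`); no `sorry`; axioms ⊆ {propext, Classical.choice, Quot.sound}; `BetaPertH`, (B), G-an2-4 occur nowhere.
Finite T⁴ rung (B)+1 — NOT infinite volume, NOT a mass gap, NOT the Clay problem; spine PROVED 0∕9.  HONEST DEPENDENCY (cell page 1):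
continuum YM on T⁴ ⇐ BetaPertH ∧ nine spine estimates (0/9 proved); BetaPertH ⇐ (D1) ∧ (D4) ∧ CAP+tail; G-an2-4 gates asym, D1 and
NE2/3/4.  Context: T. Bałaban, Commun. Math. Phys. **102** (1985) 277–309 [Balaban1985Variational], Thm 1 (8)–(9) p. 279.
PLACEMENT (human rule 2026-08-19): under `Summits/QuantumFields/BalabanUV/`.
-/

set_option autoImplicit false

open scoped BigOperators Matrix Matrix.Norms.L2Operator
open NormedSpace

namespace Summit.QuantumFields.BalabanUV.T4Continuum.MinimalActionHexDictionary

open Literature.MathematicalPhysics.QuantumFieldTheory.Balaban1983to89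
open B7Prop1Explicit B7Prop2Explicit MatrixLog UnitaryModel
open T4AveragingDeficitWall hiding Site Plane Plaq Bond
open T4AveragingDeficitWallBoundary (IsPeriodicCfg)
open AveragingDeficitCounting (mem_box_iff box_mono)
open AveragingDeficitLatticeH2Prep (fd)
open AveragingDeficitKDatum (kRem kRem_nonneg' kRem_le' mem_box_add_of_l1)
open MinimalActionSandwich (IsMinimiser)
open MinimalActionRate (sfClass)
open MinimalActionRefine (RegularSup)
open RegularSupOfGauge (regularSup_of_localGauge)
open SkeletonLattice (cdiv cmod smul_cdiv_add_cmod cmod_nonneg cmod_lt)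

noncomputable section

variable {d : ℕ} {n : Type*} [Fintype n] [DecidableEq n]

/-! ## §1 The (9)_{β=1} gauge datum: per-site and per-cube SHAPES -/

variable (d) in
/-- THE PER-SITE (9)_{β=1} DATUM at `x` (= the hypothesis `hgauge x` of `RegularSupOfGauge.regularSup_of_localGauge`, named):
a unitary site gauge `u` and a potential `a` with `U^u(b) = exp a(b)`, `‖a(b)‖ ≤ α₀` on the bonds within `ℓ¹`-distance 2 of `x`,
`‖∇_i a_τ‖ ≤ α₁` within distance 1, and ALL mixed second differences `‖∇_i∇_l a_τ(x)‖ ≤ α₂` at `x`.  A hypothesis SHAPE. [folklore] -/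
@[folklore]
def ExpGauge11 (U : Site d → Fin d → (Matrix n n ℂ)ˣ) (x : Site d) (α₀ α₁ α₂ : ℝ) : Prop :=
  ∃ (u : Site d → (Matrix n n ℂ)ˣ) (a : Site d → Fin d → Matrix n n ℂ), (∀ z, u z ∈ unitaryUnits (Matrix n n ℂ)) ∧
    (∀ (y : Site d) (τ : Fin d), l1 (y - x) ≤ 2 → ((gaugeAct u U y τ : (Matrix n n ℂ)ˣ) : Matrix n n ℂ) = exp (a y τ)) ∧
    (∀ (y : Site d) (τ : Fin d), l1 (y - x) ≤ 2 → ‖a y τ‖ ≤ α₀) ∧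
    (∀ (y : Site d) (τ i : Fin d), l1 (y - x) ≤ 1 → ‖fd i (fun z => a z τ) y‖ ≤ α₁) ∧
    (∀ (τ i l : Fin d), ‖fd i (fd l (fun z => a z τ)) x‖ ≤ α₂)

variable (d) in
/-- **THE PER-CUBE (9)_{β=1} DATUM** on `box K y` (B11 Thm 1 (8)+(9) p. 279 TYPE: ONE gauge per print-admissible cube):
a unitary site gauge `u` and a potential `a` with `U^u = exp a`, `‖a‖ ≤ α₀`, `‖∇_i a‖ ≤ α₁` and `‖∇_i∇_l a‖ ≤ α₂` at every site
of the cube — `AveragingDeficitKDatum.ExpGauge` with the Laplacian slot replaced by all second differences.  A hypothesis SHAPE,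
asserted for no configuration except the flat one. [folklore] -/
@[folklore]
def ExpGaugeCube11 (U : Site d → Fin d → (Matrix n n ℂ)ˣ) (y : Site d) (K : ℕ) (α₀ α₁ α₂ : ℝ) : Prop :=
  ∃ (u : Site d → (Matrix n n ℂ)ˣ) (a : Site d → Fin d → Matrix n n ℂ), (∀ z, u z ∈ unitaryUnits (Matrix n n ℂ)) ∧
    (∀ (z : Site d) (τ : Fin d), z ∈ box K y → ((gaugeAct u U z τ : (Matrix n n ℂ)ˣ) : Matrix n n ℂ) = exp (a z τ)) ∧
    (∀ (z : Site d) (τ : Fin d), z ∈ box K y → ‖a z τ‖ ≤ α₀) ∧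
    (∀ (z : Site d) (τ i : Fin d), z ∈ box K y → ‖fd i (fun w => a w τ) z‖ ≤ α₁) ∧
    (∀ (z : Site d) (τ i l : Fin d), z ∈ box K y → ‖fd i (fd l (fun w => a w τ)) z‖ ≤ α₂)

/-- NON-VACUITY: the flat configuration carries the cube datum `u = 1`, `a = 0` with all radii `0`. [folklore] -/
theorem expGaugeCube11_flat (y : Site d) (K : ℕ) :
    ExpGaugeCube11 d (fun (_ : Site d) (_ : Fin d) => (1 : (Matrix n n ℂ)ˣ)) y K 0 0 0 := by
  refine ⟨fun _ => 1, fun _ _ => 0, fun _ => (unitaryUnits (Matrix n n ℂ)).one_mem, fun z τ _ => ?_, fun _ _ _ => by simp,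
    fun _ _ _ _ => by simp [fd], fun _ _ _ _ _ => by simp [fd]⟩
  simp [gaugeAct]

/-! ## §2 Item (a): the cube-to-site covering -/

/-- **CUBE ⟹ SITE**: if `x ∈ box R y` and `R + 2 ≤ K`, the cube datum on `box K y` gives the per-site datum at `x` (the
`ℓ¹`-ball of radius 2 about `x` lies in `box (R+2) y ⊆ box K y`). [folklore] -/
theorem expGauge11_of_cube {U : Site d → Fin d → (Matrix n n ℂ)ˣ} {y x : Site d} {R K : ℕ} (hx : x ∈ box R y) (hK : R + 2 ≤ K)
    {α₀ α₁ α₂ : ℝ} (h : ExpGaugeCube11 d U y K α₀ α₁ α₂) : ExpGauge11 d U x α₀ α₁ α₂ := by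
  obtain ⟨u, a, hu, he, h0, h1, h2⟩ := h
  have hin2 : ∀ z : Site d, l1 (z - x) ≤ 2 → z ∈ box K y :=
    fun z hz => box_mono hK y (mem_box_add_of_l1 hx hz)
  have hin1 : ∀ z : Site d, l1 (z - x) ≤ 1 → z ∈ box K y :=
    fun z hz => box_mono (by omega) y (mem_box_add_of_l1 (m := 1) hx hz)
  have hx' : x ∈ box K y := box_mono (by omega) y hx
  exact ⟨u, a, hu, fun z τ hz => he z τ (hin2 z hz), fun z τ hz => h0 z τ (hin2 z hz),
    fun z τ i hz => h1 z τ i (hin1 z hz), fun τ i l => h2 x τ i l hx'⟩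

/-- Every site lies in the cube of radius `B − 1` based at the corner of its block: `x ∈ box (B−1) (B • cdiv B x)`. [folklore] -/
theorem mem_box_cdiv {B : ℕ} (hB : 1 ≤ B) (x : Site d) : x ∈ box (B - 1) ((B : ℤ) • cdiv B x) := by
  rw [mem_box_iff]
  intro κ
  have h := congr_fun (smul_cdiv_add_cmod B x) κ
  simp only [Pi.add_apply, Pi.smul_apply, smul_eq_mul] at h
  have h0 := cmod_nonneg hB x κ
  have h1 := cmod_lt hB x κ
  have hB' : ((B - 1 : ℕ) : ℤ) = (B : ℤ) - 1 := by omega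
  rw [hB', abs_le]
  simp only [Pi.smul_apply, smul_eq_mul]
  constructor <;> linarith

/-- **CUBES AROUND EVERY BLOCK ⟹ THE SITE DATUM EVERYWHERE**: cube data on `box (B + 1) (B • q)` for every block index `q`
(`B ≥ 1`) give the per-site datum at every site. [folklore] -/
theorem expGauge11_of_blockCubes {U : Site d → Fin d → (Matrix n n ℂ)ˣ} {B : ℕ} (hB : 1 ≤ B) {α₀ α₁ α₂ : ℝ}
    (h : ∀ q : Site d, ExpGaugeCube11 d U ((B : ℤ) • q) (B + 1) α₀ α₁ α₂) (x : Site d) : ExpGauge11 d U x α₀ α₁ α₂ :=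
  expGauge11_of_cube (mem_box_cdiv hB x) (by omega) (h (cdiv B x))

/-! ## §3 Item (c): the `k`-uniform constant at the printed scales -/

/-- Scale arithmetic: for `s ≥ 1`, `0 ≤ c₀, c₁ ≤ 1/8`:
`(2(c₂/s³) + kRem (c₀/s) (c₁/s²))·s³ ≤ 2c₂ + 90c₀c₁ + 32c₁² + 360c₀³`. [folklore] -/
theorem scale_kRem {s c₀ c₁ c₂ : ℝ} (hs : 1 ≤ s) (hc₀ : 0 ≤ c₀) (hc₀' : c₀ ≤ 1 / 8) (hc₁ : 0 ≤ c₁) (hc₁' : c₁ ≤ 1 / 8) :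
    (2 * (c₂ / s ^ 3) + kRem (c₀ / s) (c₁ / s ^ 2)) * s ^ 3 ≤ 2 * c₂ + 90 * c₀ * c₁ + 32 * c₁ ^ 2 + 360 * c₀ ^ 3 := by
  have hs0 : 0 < s := by linarith
  have hs1' : 1 ≤ s ^ 2 := one_le_pow₀ hs
  have hα₀0 : 0 ≤ c₀ / s := by positivity
  have hα₁0 : 0 ≤ c₁ / s ^ 2 := by positivity
  have hα₀' : c₀ / s ≤ 1 / 8 := (div_le_self hc₀ hs).trans hc₀'
  have hα₁' : c₁ / s ^ 2 ≤ 1 / 8 := (div_le_self hc₁ hs1').trans hc₁'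
  have hk := kRem_le' hα₀0 hα₁0 hα₀' hα₁'
  have e1 : (90 * (c₀ / s) * (c₁ / s ^ 2) + 32 * (c₁ / s ^ 2) ^ 2 + 360 * (c₀ / s) ^ 3) * s ^ 3
      = 90 * c₀ * c₁ + 32 * c₁ ^ 2 / s + 360 * c₀ ^ 3 := by
    field_simp
  have e2 : 32 * c₁ ^ 2 / s ≤ 32 * c₁ ^ 2 := div_le_self (by positivity) hs
  have e3 : 2 * (c₂ / s ^ 3) * s ^ 3 = 2 * c₂ := by field_simp
  have hs3 : 0 ≤ s ^ 3 := by positivity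
  calc (2 * (c₂ / s ^ 3) + kRem (c₀ / s) (c₁ / s ^ 2)) * s ^ 3
      = 2 * (c₂ / s ^ 3) * s ^ 3 + kRem (c₀ / s) (c₁ / s ^ 2) * s ^ 3 := by ring
    _ ≤ 2 * c₂ + (90 * (c₀ / s) * (c₁ / s ^ 2) + 32 * (c₁ / s ^ 2) ^ 2 + 360 * (c₀ / s) ^ 3) * s ^ 3 := by
        rw [e3]; exact add_le_add le_rfl (mul_le_mul_of_nonneg_right hk hs3)
    _ = 2 * c₂ + (90 * c₀ * c₁ + 32 * c₁ ^ 2 / s + 360 * c₀ ^ 3) := by rw [e1]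
    _ ≤ 2 * c₂ + 90 * c₀ * c₁ + 32 * c₁ ^ 2 + 360 * c₀ ^ 3 := by linarith

/-- **`RegularSup` WITH A `k`-FREE CONSTANT FROM CUBE DATA AT THE PRINTED SCALES** (items (a)+(c) over the owner's (b)): a unitary,
`(N·L^k)`-periodic configuration with `SmallField U (b/(L^k)²)`, `b ≤ 1/2`, carrying on the cube `box (L^k + 1) (L^k • q)` of every
block index `q` the (9)_{β=1} datum with radii `c₀/L^k`, `c₁/(L^k)²`, `c₂/(L^k)³` (`0 ≤ c₀, c₁ ≤ 1/8`; dictionary in the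
all-small-field case `L^kη = 1`: `c₀ = c₁ = B₃Mε₁`, `c₂ = B₄(1)Mε₁`) has `RegularSup d L N b (2c₂ + 90c₀c₁ + 32c₁² + 360c₀³) k U`.
[folklore] -/
theorem regularSup_of_blockCubes [Nonempty n] {L N k : ℕ} (hL : 1 ≤ L) {U : Site d → Fin d → (Matrix n n ℂ)ˣ}
    (hU : IsUnitaryCfg U) (hP : IsPeriodicCfg U ((N * L ^ k : ℕ) : ℤ)) {b : ℝ} (hS : SmallField U (b / ((L : ℝ) ^ k) ^ 2))
    (hb : b ≤ 1 / 2) {c₀ c₁ c₂ : ℝ} (hc₀ : 0 ≤ c₀) (hc₀' : c₀ ≤ 1 / 8) (hc₁ : 0 ≤ c₁) (hc₁' : c₁ ≤ 1 / 8)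
    (hG : ∀ q : Site d, ExpGaugeCube11 d U (((L ^ k : ℕ) : ℤ) • q) (L ^ k + 1)
      (c₀ / (L : ℝ) ^ k) (c₁ / ((L : ℝ) ^ k) ^ 2) (c₂ / ((L : ℝ) ^ k) ^ 3)) :
    RegularSup d L N b (2 * c₂ + 90 * c₀ * c₁ + 32 * c₁ ^ 2 + 360 * c₀ ^ 3) k U := by
  have hL1 : (1 : ℝ) ≤ L := by exact_mod_cast hL
  have hsk : (1 : ℝ) ≤ (L : ℝ) ^ k := one_le_pow₀ hL1
  have hB : 1 ≤ L ^ k := Nat.one_le_pow _ _ hL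
  have hα₀0 : 0 ≤ c₀ / (L : ℝ) ^ k := by positivity
  have hα₁0 : 0 ≤ c₁ / ((L : ℝ) ^ k) ^ 2 := by positivity
  have hα₀' : c₀ / (L : ℝ) ^ k ≤ 1 / 8 := (div_le_self hc₀ hsk).trans hc₀'
  have hα₁' : c₁ / ((L : ℝ) ^ k) ^ 2 ≤ 1 / 8 := (div_le_self hc₁ (one_le_pow₀ hsk)).trans hc₁'
  have hsite := expGauge11_of_blockCubes (d := d) hB hG
  refine regularSup_of_localGauge hL hU hP hS hb hα₀0 hα₁0 hα₀' hα₁' (fun x => hsite x) ?_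
  exact scale_kRem hsk hc₀ hc₀' hc₁ hc₁'

/-! ## §4 The re-instantiation: one minimiser per level in (8) with (9)_{β=1} cube data ⟹ (H∃) -/

/-- **(H∃) FROM THE TYPED GLOBAL READING OF B11 THEOREM 1** (label D-s3-2; the reading is a HYPOTHESIS, asserted for nothing):
if for every datum `V ∈ dom` and every level `k` SOME minimiser `U` of run `k` over the class `sfClass d L N ε` (radius `ε` = the
class radius ε₀ of (6)) lies in the smaller class `sfClass d L N b k` (radius `b` = B₃ε₁ of (8), `b ≤ 1/2`) and carries the (9)_{β=1}
cube datum at the printed scales around every block, then (H∃) holds with the `k`-FREE sup-form regularity constant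
`c = 2c₂ + 90c₀c₁ + 32c₁² + 360c₀³` — the binder `hmin` of `MinimalActionRateExists.actionRate_sfClass_of_exists_approxRefine` ∕ the
owner's `MinimalActionThm1Type`.  NE3 is NOT proved: this only renames the variational input. [folklore] -/
theorem hex_of_thm1Global [Nonempty n] {L N : ℕ} (hL : 1 ≤ L) {ε b c₀ c₁ c₂ : ℝ} (hb : b ≤ 1 / 2)
    (hc₀ : 0 ≤ c₀) (hc₀' : c₀ ≤ 1 / 8) (hc₁ : 0 ≤ c₁) (hc₁' : c₁ ≤ 1 / 8)
    {dom : Set (Site d → Fin d → (Matrix n n ℂ)ˣ)}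
    (hmin : ∀ V ∈ dom, ∀ k : ℕ, ∃ U : Site d → Fin d → (Matrix n n ℂ)ˣ,
      IsMinimiser d (sfClass d L N ε) L N k V U ∧ U ∈ sfClass (d := d) L N b k ∧
      ∀ q : Site d, ExpGaugeCube11 d U (((L ^ k : ℕ) : ℤ) • q) (L ^ k + 1)
        (c₀ / (L : ℝ) ^ k) (c₁ / ((L : ℝ) ^ k) ^ 2) (c₂ / ((L : ℝ) ^ k) ^ 3)) :
    ∀ V ∈ dom, ∀ k : ℕ, ∃ U : Site d → Fin d → (Matrix n n ℂ)ˣ,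
      IsMinimiser d (sfClass d L N ε) L N k V U ∧ RegularSup d L N b (2 * c₂ + 90 * c₀ * c₁ + 32 * c₁ ^ 2 + 360 * c₀ ^ 3) k U := by
  intro V hV k
  obtain ⟨U, hUmin, hUcl, hG⟩ := hmin V hV k
  exact ⟨U, hUmin, regularSup_of_blockCubes hL hUcl.1 hUcl.2.1 hUcl.2.2 hb hc₀ hc₀' hc₁ hc₁' hG⟩

/-! ## §5 Non-vacuity -/

/-- The flat configuration is `RegularSup d L N 0 0 k` through this dictionary. [folklore] -/
theorem regularSup_flat_of_blockCubes [Nonempty n] (L N k : ℕ) (hL : 1 ≤ L) :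
    RegularSup d L N 0 0 k (fun (_ : Site d) (_ : Fin d) => (1 : (Matrix n n ℂ)ˣ)) := by
  have hG : ∀ q : Site d, ExpGaugeCube11 d (fun (_ : Site d) (_ : Fin d) => (1 : (Matrix n n ℂ)ˣ)) (((L ^ k : ℕ) : ℤ) • q)
      (L ^ k + 1) (0 / (L : ℝ) ^ k) (0 / ((L : ℝ) ^ k) ^ 2) (0 / ((L : ℝ) ^ k) ^ 3) := by
    intro q; simp only [zero_div]; exact expGaugeCube11_flat _ _
  have h := regularSup_of_blockCubes (N := N) (b := 0) hL (fun _ _ => (unitaryUnits (Matrix n n ℂ)).one_mem)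
    (fun _ _ _ => rfl) (fun x κ κ' _ => by simp [hol_flat]) (by norm_num) le_rfl (by norm_num) le_rfl (by norm_num) hG
  simpa using h

end

end Summit.QuantumFields.BalabanUV.T4Continuum.MinimalActionHexDictionary
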